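import Mathlib.RingTheory.Nilpotent.Lemmas
import Mathlib.LinearAlgebra.Matrix.Ideal
import Mathlib.RingTheory.Ideal.Quotient.Nilpotent
import Mathlib.RingTheory.Ideal.Quotient.Operations
import Mathlib.RingTheory.AdicCompletion.Basic
import Literature.RepresentationTheory.FiniteGroups.CoprimeOrderLift
import HarnessLib

/-!
# Proof of Serre §15.5 Prop. 43: lifting prime-to-`p` representations to the valuation ring

This file PROVES the named fact `Literature.RepresentationTheory.FiniteGroups.SerreLRFG.prop43_lift`
(`Literature.RepresentationTheory.FiniteGroups.CoprimeOrderLift`; Serre, *Linear Representations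
of Finite Groups*, §15.5, Prop. 43 with the Remark and Ex. 15.9): for a complete discrete
valuation ring `A` with residue field `k` of characteristic `p` and a finite group `G` of order
prime to `p`, every `σ : G → GL_n(k)` is the reduction of some `θ : G → GL_n(A)`.

The proof given here is the cohomological one (vanishing of `H²(G, M_n(I))` for `|G|`
invertible, by averaging), not Serre's via projective `A[G]`-modules:

* matrices with entries in an ideal are Mathlib's `Ideal.matrix` (`X ∈ I.matrix n`);
* `exists_lift_of_sq_eq_bot` — the inductive step: if `I ⊆ R` is an ideal with `I² = 0` and
  `|G|` is invertible in `R`, every `θ : G → GL_n(R/I)` lifts to `GL_n(R)`. Choose unit lifts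
  `u(g)`, write `u(g)u(h)u(gh)⁻¹ = 1 + D(g,h)` with `D(g,h) ∈ M_n(I)`; the cocycle identity
  `D(g,h) + D(gh,k) = u(g)D(h,k)u(g)⁻¹ + D(g,hk)` averaged over `k` gives
  `D(g,h) = u(g)B(h)u(g)⁻¹ + B(g) − B(gh)` for `B(g) = |G|⁻¹ ∑_k D(g,k)`, and then
  `g ↦ (1 − B(g))u(g)` is multiplicative.
* `prop43_lift_holds` — iterate over the tower `A/𝔪^{i+1}` (the kernel of
  `A/𝔪^{i+2} → A/𝔪^{i+1}` has square zero) and pass to the limit using that `A` is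
  `𝔪`-adically complete (`IsAdicComplete`: precomplete and Hausdorff); the limit is invertible
  because its determinant is a unit modulo `𝔪`. Only "`A` local, `𝔪`-adically complete, `|G|`
  a unit" is used.

## References

* J.-P. Serre, *Linear Representations of Finite Groups*, GTM 42 (1977), §15.5, Prop. 43.
* P. Deligne, J.-P. Serre, *Formes modulaires de poids 1*, Ann. Sci. ÉNS (4) 7 (1974), §8.6.
-/

open Matrix IsLocalRing

namespace Literature.RepresentationTheory.FiniteGroups

universe u v

variable {R : Type*} [CommRing R] (I : Ideal R) {n : Type*}

/-! ### Matrices with entries in an ideal: Mathlib's `Ideal.matrix` -/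

omit [CommRing R] in
/-- Surjectivity of reduction of matrices modulo an ideal. [folklore] -/
lemma exists_matrix_map_mk_eq {R : Type*} [CommRing R] {m : Type*} (J : Ideal R)
    (N : Matrix m m (R ⧸ J)) : ∃ M : Matrix m m R, M.map (Ideal.Quotient.mk J) = N := by
  choose f hf using fun i j ↦ Ideal.Quotient.mk_surjective (N i j)
  exact ⟨Matrix.of f, by ext i j; simp [hf]⟩

variable {I} [Fintype n] [DecidableEq n]

/-- Scalar multiples of a matrix with entries in `I` have entries in `I`. [folklore] -/
lemma smul_mem_matrix {X : Matrix n n R} (r : R) (hX : X ∈ I.matrix n) : r • X ∈ I.matrix n :=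
  (Ideal.mem_matrix n I _).mpr fun i j ↦ I.mul_mem_left r ((Ideal.mem_matrix n I X).mp hX i j)

/-- `I.matrix n` is also a right ideal. [folklore] -/
lemma matrix_mem_mul_right (Y : Matrix n n R) {X : Matrix n n R} (hX : X ∈ I.matrix n) :
    X * Y ∈ I.matrix n :=
  (Ideal.mem_matrix n I _).mpr fun i j ↦ by
    rw [Matrix.mul_apply]
    exact I.sum_mem fun k _ ↦ I.mul_mem_right _ ((Ideal.mem_matrix n I X).mp hX i k)

/-- If `I² = 0`, the product of two matrices with entries in `I` vanishes. [folklore] -/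
lemma mul_eq_zero_of_mem_matrix (hI : I * I = ⊥) {X Y : Matrix n n R} (hX : X ∈ I.matrix n)
    (hY : Y ∈ I.matrix n) : X * Y = 0 := by
  ext i j
  rw [Matrix.mul_apply, Matrix.zero_apply]
  refine Finset.sum_eq_zero fun k _ ↦ ?_
  have : X i k * Y k j ∈ I * I :=
    Ideal.mul_mem_mul ((Ideal.mem_matrix n I X).mp hX i k) ((Ideal.mem_matrix n I Y).mp hY k j)
  rw [hI] at this
  exact (Submodule.mem_bot R).mp this

/-- A matrix reduces to `0` modulo `I` iff its entries lie in `I`. [folklore] -/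
lemma mem_matrix_iff_map_eq_zero {X : Matrix n n R} :
    X ∈ I.matrix n ↔ X.map (Ideal.Quotient.mk I) = 0 := by
  simp only [Ideal.mem_matrix, ← Matrix.ext_iff, Matrix.map_apply, Matrix.zero_apply,
    Ideal.Quotient.eq_zero_iff_mem]


/-- `1 - B` is invertible with inverse `1 + B` when `B` has entries in a square-zero ideal.
[folklore] -/
lemma one_sub_mul_one_add_of_mem_matrix (hI : I * I = ⊥) {B : Matrix n n R} (hB : B ∈ I.matrix n) :
    (1 - B) * (1 + B) = 1 := by
  rw [sub_mul, one_mul, mul_add, mul_one, mul_eq_zero_of_mem_matrix hI hB hB]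
  abel

/-- The unit `1 - B` for `B` with entries in a square-zero ideal. [folklore] -/
def oneSubUnit (hI : I * I = ⊥) {B : Matrix n n R} (hB : B ∈ I.matrix n) : GL n R where
  val := 1 - B
  inv := 1 + B
  val_inv := one_sub_mul_one_add_of_mem_matrix hI hB
  inv_val := by
    rw [add_mul, one_mul, mul_sub, mul_one, mul_eq_zero_of_mem_matrix hI hB hB]
    abel

/-- Unfolding lemma for `oneSubUnit`. [folklore] -/
@[simp] lemma coe_oneSubUnit (hI : I * I = ⊥) {B : Matrix n n R} (hB : B ∈ I.matrix n) :
    ((oneSubUnit hI hB : GL n R) : Matrix n n R) = 1 - B := rfl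

/-- **Lifting over a square-zero ideal** (the inductive step of Serre, *Linear Representations
of Finite Groups*, §15.5, Prop. 43 / Ex. 15.9). Let `I ⊆ R` be an ideal with `I² = 0` and `G` a
finite group of order invertible in `R`. Every homomorphism `θ : G → GL_n(R/I)` lifts to a
homomorphism `θ' : G → GL_n(R)`. [cite: SerreLinearRepresentations1977, §15.5 Prop. 43] -/
theorem exists_lift_of_sq_eq_bot (hI : I * I = ⊥) {G : Type*} [Group G] [Fintype G]
    (hG : IsUnit (Fintype.card G : R)) (θ : G →* GL n (R ⧸ I)) :
    ∃ θ' : G →* GL n R,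
      (Matrix.GeneralLinearGroup.map (Ideal.Quotient.mk I)).comp θ' = θ := by
  classical
  set π : R →+* R ⧸ I := Ideal.Quotient.mk I with hπ
  have hInil : IsNilpotent I := ⟨2, by rw [pow_two, hI]; rfl⟩
  -- unit lifts `u g` of `θ g`
  have hlift : ∀ g : G, ∃ u : GL n R, Matrix.GeneralLinearGroup.map π u = θ g := by
    intro g
    obtain ⟨M, hM⟩ := exists_matrix_map_mk_eq I (θ g : Matrix n n (R ⧸ I))
    have hMu : IsUnit M := by
      rw [Matrix.isUnit_iff_isUnit_det, ← hInil.isUnit_quotient_mk_iff, RingHom.map_det]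
      change IsUnit (M.map π).det
      rw [hM, ← Matrix.isUnit_iff_isUnit_det]
      exact Units.isUnit _
    refine ⟨hMu.unit, Units.ext ?_⟩
    change (RingHom.mapMatrix π) (hMu.unit : Matrix n n R) = _
    rw [RingHom.mapMatrix_apply, IsUnit.unit_spec, hM]
  choose u hu using hlift
  -- matrices `U g`, `V g = (U g)⁻¹`
  set U : G → Matrix n n R := fun g ↦ ((u g : GL n R) : Matrix n n R) with hU
  set V : G → Matrix n n R := fun g ↦ (((u g)⁻¹ : GL n R) : Matrix n n R) with hV
  have hUV : ∀ g, U g * V g = 1 := fun g ↦ Units.mul_inv (u g)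
  have hVU : ∀ g, V g * U g = 1 := fun g ↦ Units.inv_mul (u g)
  -- the defect `D g h = U g U h V(gh) - 1` has entries in `I`
  set D : G → G → Matrix n n R := fun g h ↦ U g * U h * V (g * h) - 1 with hD
  have hUU : ∀ g h, U g * U h = (1 + D g h) * U (g * h) := fun g h ↦ by
    simp only [hD, add_sub_cancel, mul_assoc, hVU, mul_one]
  have hDI : ∀ g h, D g h ∈ I.matrix n := by
    intro g h
    rw [mem_matrix_iff_map_eq_zero]
    have h1 : Matrix.GeneralLinearGroup.map π (u g * u h * (u (g * h))⁻¹) = 1 := by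
      rw [map_mul, map_mul, map_inv, hu, hu, hu, ← map_mul, mul_inv_cancel]
    have h2 := congrArg (fun x : GL n (R ⧸ I) ↦ (x : Matrix n n (R ⧸ I))) h1
    simp only [Units.val_one] at h2
    change (RingHom.mapMatrix π) (U g * U h * V (g * h)) = 1 at h2
    change (RingHom.mapMatrix π) (U g * U h * V (g * h) - 1) = 0
    rw [map_sub, h2, map_one, sub_self]
  -- the cocycle identity `D g h + D (gh) k = U g D h k V g + D g (hk)`
  have hcoc : ∀ g h k, D g h + D (g * h) k = U g * D h k * V g + D g (h * k) := by
    intro g h k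
    -- both sides `+ 1`, multiplied on the right by `U (g h k)`, equal `U g U h U k`
    have z1 : D g h * D (g * h) k = 0 := mul_eq_zero_of_mem_matrix hI (hDI _ _) (hDI _ _)
    have hconj : U g * D h k * V g ∈ I.matrix n :=
      matrix_mem_mul_right _ (Ideal.mul_mem_left _ _ (hDI _ _))
    have z2 : U g * D h k * V g * D g (h * k) = 0 := mul_eq_zero_of_mem_matrix hI hconj (hDI _ _)
    have lhs : U g * U h * U k = (1 + D g h + D (g * h) k) * U (g * h * k) := by
      rw [hUU g h, mul_assoc, hUU (g * h) k, ← mul_assoc]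
      congr 1
      rw [add_mul, one_mul, mul_add, mul_one, z1]
      abel
    have rhs : U g * U h * U k = (1 + U g * D h k * V g + D g (h * k)) * U (g * h * k) := by
      rw [mul_assoc, hUU h k, ← mul_assoc]
      have e1 : U g * (1 + D h k) = (1 + U g * D h k * V g) * U g := by
        rw [mul_add, mul_one, add_mul, one_mul, mul_assoc (U g * D h k), hVU, mul_one]
      rw [e1, mul_assoc _ (U g), hUU g (h * k), ← mul_assoc, mul_assoc g h k]
      congr 1
      simp only [add_mul, mul_add, one_mul, mul_one, z2]
      abel
    -- cancel the unit `U (g h k)` on the right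
    have hcancel : (1 + D g h + D (g * h) k) = (1 + U g * D h k * V g + D g (h * k)) := by
      have := congrArg (fun X ↦ X * V (g * h * k)) (lhs.symm.trans rhs)
      simpa only [mul_assoc, hUV, mul_one] using this
    have := congrArg (fun X ↦ X - 1) hcancel
    simp only [add_assoc, add_sub_cancel_left] at this
    exact this
  -- averaging: `B g = |G|⁻¹ ∑_k D g k`
  obtain ⟨m, hm⟩ := hG
  set e₀ : R := ((m⁻¹ : Rˣ) : R) with he₀
  have hme : e₀ * (Fintype.card G : R) = 1 := by rw [← hm, he₀, Units.inv_mul]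
  set B : G → Matrix n n R := fun g ↦ e₀ • ∑ k, D g k with hB
  have hBI : ∀ g, B g ∈ I.matrix n := fun g ↦
    smul_mem_matrix _ (Submodule.sum_mem _ fun k _ ↦ hDI g k)
  have hDB : ∀ g h, D g h = U g * B h * V g + B g - B (g * h) := by
    intro g h
    have hsum := Finset.sum_congr rfl fun k (_ : k ∈ (Finset.univ : Finset G)) ↦ hcoc g h k
    rw [Finset.sum_add_distrib, Finset.sum_add_distrib, Finset.sum_const, Finset.card_univ,
      ← Finset.sum_mul, ← Finset.mul_sum] at hsum
    have hre : ∑ k, D g (h * k) = ∑ k, D g k :=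
      Fintype.sum_equiv (Equiv.mulLeft h) _ _ fun k ↦ rfl
    rw [hre] at hsum
    have h1 := congrArg (fun X : Matrix n n R ↦ e₀ • X) hsum
    rw [smul_add, smul_add] at h1
    have hcard : e₀ • (Fintype.card G • D g h) = D g h := by
      rw [← Nat.cast_smul_eq_nsmul R, smul_smul, hme, one_smul]
    rw [hcard, ← Matrix.smul_mul, ← Matrix.mul_smul] at h1
    -- h1 : D g h + B (g h) = U g * B h * V g + B g
    simp only [hB]
    exact eq_sub_of_add_eq h1
  -- the corrected lift `s' g = (1 - B g) u g`
  set s' : G → GL n R := fun g ↦ oneSubUnit hI (hBI g) * u g with hs'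
  have hmul : ∀ g h, s' (g * h) = s' g * s' h := by
    intro g h
    apply Units.ext
    simp only [hs', Units.val_mul, coe_oneSubUnit]
    change (1 - B (g * h)) * U (g * h) = (1 - B g) * U g * ((1 - B h) * U h)
    have hc1 : U g * B h * V g ∈ I.matrix n :=
      matrix_mem_mul_right _ (Ideal.mul_mem_left _ _ (hBI h))
    have z1 : B g * (U g * B h * V g) = 0 := mul_eq_zero_of_mem_matrix hI (hBI g) hc1
    have z2 : B g * D g h = 0 := mul_eq_zero_of_mem_matrix hI (hBI g) (hDI g h)
    have z3 : U g * B h * V g * D g h = 0 := mul_eq_zero_of_mem_matrix hI hc1 (hDI g h)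
    have e1 : U g * (1 - B h) = (1 - U g * B h * V g) * U g := by
      rw [mul_sub, mul_one, sub_mul, one_mul, mul_assoc (U g * B h), hVU, mul_one]
    symm
    calc (1 - B g) * U g * ((1 - B h) * U h)
        = (1 - B g) * (U g * (1 - B h)) * U h := by simp only [mul_assoc]
      _ = (1 - B g) * (1 - U g * B h * V g) * ((1 + D g h) * U (g * h)) := by
          rw [e1, ← mul_assoc, mul_assoc _ (U g) (U h), hUU g h]
      _ = (1 - B g - U g * B h * V g + D g h) * U (g * h) := by
          rw [← mul_assoc]
          congr 1
          simp only [sub_mul, mul_sub, one_mul, mul_one, mul_add, sub_add, z1, z2, z3, sub_zero]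
      _ = (1 - B (g * h)) * U (g * h) := by rw [hDB g h]; abel_nf
  refine ⟨MonoidHom.mk' s' hmul, ?_⟩
  ext g : 1
  simp only [MonoidHom.coe_comp, Function.comp_apply, MonoidHom.mk'_apply, hs', map_mul, hu]
  have : Matrix.GeneralLinearGroup.map π (oneSubUnit hI (hBI g)) = 1 := by
    apply Units.ext
    change ((RingHom.mapMatrix π) (1 - B g)) = 1
    rw [map_sub, map_one, sub_eq_self]
    exact (mem_matrix_iff_map_eq_zero).mp (hBI g)
  rw [this, one_mul]


/-! ### The tower `A / 𝔪^{i+1}` and the limit -/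

section Tower

variable {A : Type*} [CommRing A] [IsLocalRing A]

variable (A) in
/-- The ideal `𝔪^{i+1}` reduced modulo `𝔪^{i+2}`: the kernel of `A/𝔪^{i+2} → A/𝔪^{i+1}`, an
ideal of square zero. [folklore] -/
def stepIdeal (i : ℕ) : Ideal (A ⧸ maximalIdeal A ^ (i + 2)) :=
  (maximalIdeal A ^ (i + 1)).map (Ideal.Quotient.mk (maximalIdeal A ^ (i + 2)))

/-- The step ideal has square zero (`2(i+1) ≥ i+2`). [folklore] -/
lemma stepIdeal_mul_self (i : ℕ) : stepIdeal A i * stepIdeal A i = ⊥ := by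
  rw [stepIdeal, ← Ideal.map_mul, ← pow_add]
  refine le_bot_iff.mp ?_
  calc Ideal.map (Ideal.Quotient.mk (maximalIdeal A ^ (i + 2))) (maximalIdeal A ^ (i + 1 + (i + 1)))
      ≤ Ideal.map (Ideal.Quotient.mk (maximalIdeal A ^ (i + 2))) (maximalIdeal A ^ (i + 2)) :=
        Ideal.map_mono (Ideal.pow_le_pow_right (by omega))
    _ = ⊥ := Ideal.map_quotient_self _

/-- `𝔪^{i+2} ≤ 𝔪^{i+1}`. [folklore] -/
lemma maximalIdeal_pow_succ_le (i : ℕ) : maximalIdeal A ^ (i + 2) ≤ maximalIdeal A ^ (i + 1) :=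
  Ideal.pow_le_pow_right (by omega)

/-- `(A/𝔪^{i+2}) / (𝔪^{i+1}/𝔪^{i+2}) ≃ A/𝔪^{i+1}` (third isomorphism theorem). [folklore] -/
abbrev stepEquiv (i : ℕ) :
    ((A ⧸ maximalIdeal A ^ (i + 2)) ⧸ stepIdeal A i) ≃+* A ⧸ maximalIdeal A ^ (i + 1) :=
  DoubleQuot.quotQuotEquivQuotOfLE (maximalIdeal_pow_succ_le i)

/-- Compatibility of `stepEquiv` with the quotient maps. [folklore] -/
lemma stepEquiv_mk_mk (i : ℕ) (x : A) :
    stepEquiv i (Ideal.Quotient.mk (stepIdeal A i)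
      (Ideal.Quotient.mk (maximalIdeal A ^ (i + 2)) x)) =
      Ideal.Quotient.mk (maximalIdeal A ^ (i + 1)) x :=
  DoubleQuot.quotQuotEquivQuotOfLE_quotQuotMk x (maximalIdeal_pow_succ_le i)

variable {G : Type*} [Group G] [Fintype G] {n : Type*} [Fintype n] [DecidableEq n]

/-- One step up the tower: a representation over `A/𝔪^{i+1}` lifts to `A/𝔪^{i+2}` when
`|G|` is a unit of `A`. [folklore] -/
lemma exists_lift_step (hG : IsUnit (Fintype.card G : A)) (i : ℕ)
    (θ : G →* GL n (A ⧸ maximalIdeal A ^ (i + 1))) :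
    ∃ θ' : G →* GL n (A ⧸ maximalIdeal A ^ (i + 2)),
      (Matrix.GeneralLinearGroup.map (Ideal.Quotient.factor (maximalIdeal_pow_succ_le i))).comp θ' =
        θ := by
  -- transport `θ` to the double quotient and lift over the square-zero ideal
  set e := stepEquiv (A := A) i with he
  set θe : G →* GL n ((A ⧸ maximalIdeal A ^ (i + 2)) ⧸ stepIdeal A i) :=
    (Matrix.GeneralLinearGroup.map e.symm.toRingHom).comp θ with hθe
  have hGi : IsUnit (Fintype.card G : A ⧸ maximalIdeal A ^ (i + 2)) := by
    simpa using hG.map (Ideal.Quotient.mk (maximalIdeal A ^ (i + 2)))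
  obtain ⟨θ', hθ'⟩ := exists_lift_of_sq_eq_bot (stepIdeal_mul_self i) hGi θe
  refine ⟨θ', ?_⟩
  -- `factor = e ∘ mk (stepIdeal)`
  have hfac : Ideal.Quotient.factor (maximalIdeal_pow_succ_le i) =
      e.toRingHom.comp (Ideal.Quotient.mk (stepIdeal A i)) := by
    refine Ideal.Quotient.ringHom_ext ?_
    ext x
    simp [he, stepEquiv_mk_mk]
  rw [hfac, Matrix.GeneralLinearGroup.map_comp, MonoidHom.comp_assoc, hθ', hθe,
    ← MonoidHom.comp_assoc, ← Matrix.GeneralLinearGroup.map_comp]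
  have : e.toRingHom.comp e.symm.toRingHom = RingHom.id _ := by
    ext x; simp
  rw [this]
  ext g : 1
  simp

variable (hG : IsUnit (Fintype.card G : A)) (θ₀ : G →* GL n (A ⧸ maximalIdeal A ^ (0 + 1)))

/-- The compatible tower of lifts `θ_i : G → GL_n(A/𝔪^{i+1})`, by recursion. [folklore] -/
noncomputable def liftSeq : (i : ℕ) → (G →* GL n (A ⧸ maximalIdeal A ^ (i + 1)))
  | 0 => θ₀
  | i + 1 => Classical.choose (exists_lift_step hG i (liftSeq i))

/-- `θ_{i+1}` reduces to `θ_i`. [folklore] -/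
lemma liftSeq_succ (i : ℕ) :
    (Matrix.GeneralLinearGroup.map (Ideal.Quotient.factor (maximalIdeal_pow_succ_le i))).comp
      (liftSeq hG θ₀ (i + 1)) = liftSeq hG θ₀ i :=
  Classical.choose_spec (exists_lift_step hG i (liftSeq hG θ₀ i))

/-- Entrywise: the matrices of `θ_{i+1}(g)` reduce to those of `θ_i(g)`. [folklore] -/
lemma liftSeq_succ_apply (i : ℕ) (g : G) (j k : n) :
    Ideal.Quotient.factor (maximalIdeal_pow_succ_le i)
      (((liftSeq hG θ₀ (i + 1) g : GL n (A ⧸ maximalIdeal A ^ (i + 2))) :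
        Matrix n n (A ⧸ maximalIdeal A ^ (i + 2))) j k) =
      ((liftSeq hG θ₀ i g : GL n (A ⧸ maximalIdeal A ^ (i + 1))) :
        Matrix n n (A ⧸ maximalIdeal A ^ (i + 1))) j k := by
  have := congrArg (fun φ : G →* GL n (A ⧸ maximalIdeal A ^ (i + 1)) ↦
    ((φ g : GL n (A ⧸ maximalIdeal A ^ (i + 1))) : Matrix n n (A ⧸ maximalIdeal A ^ (i + 1))) j k)
    (liftSeq_succ hG θ₀ i)
  simpa [Matrix.GeneralLinearGroup.map_apply] using this

end Tower

/-! ### Prop. 43 -/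

section Main

/-- **Serre, *Linear Representations of Finite Groups*, §15.5 Prop. 43 (lifting form), proved.**
For a local ring `A`, complete and separated for the `𝔪`-adic topology, and a finite group `G`
whose order is a unit of `A`, every representation `σ : G → GL_n(A/𝔪)` lifts to
`θ : G → GL_n(A)`. [cite: SerreLinearRepresentations1977, §15.5 Prop. 43] -/
theorem exists_lift_of_isAdicComplete {A : Type*} [CommRing A] [IsLocalRing A]
    [IsAdicComplete (maximalIdeal A) A] {G : Type*} [Group G] [Fintype G]
    (hG : IsUnit (Fintype.card G : A)) {n : Type*} [Fintype n] [DecidableEq n]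
    (σ : G →* GL n (ResidueField A)) :
    ∃ θ : G →* GL n A, (Matrix.GeneralLinearGroup.map (residue A)).comp θ = σ := by
  classical
  set 𝔪 := maximalIdeal A with h𝔪
  -- `σ` as a representation over `A / 𝔪^1`
  have h1 : 𝔪 ^ (0 + 1) = 𝔪 := by rw [zero_add, pow_one]
  set e₁ : (A ⧸ 𝔪 ^ (0 + 1)) ≃+* A ⧸ 𝔪 := Ideal.quotEquivOfEq h1 with he₁
  set σ' : G →* GL n (A ⧸ 𝔪) := σ with hσ'
  set θ₀ : G →* GL n (A ⧸ 𝔪 ^ (0 + 1)) :=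
    (Matrix.GeneralLinearGroup.map e₁.symm.toRingHom).comp σ' with hθ₀
  -- the tower and entrywise lifts to `A`
  set T := liftSeq hG θ₀ with hT
  have hlift : ∀ (i : ℕ) (g : G), ∃ M : Matrix n n A,
      M.map (Ideal.Quotient.mk (𝔪 ^ (i + 1))) = ((T i g : GL n _) : Matrix n n _) :=
    fun i g ↦ exists_matrix_map_mk_eq _ _
  choose a ha using hlift
  -- compatibility of the lifts
  have hcompat : ∀ (i : ℕ) (g : G) (j k : n), a (i + 1) g j k - a i g j k ∈ 𝔪 ^ (i + 1) := by
    intro i g j k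
    rw [← Ideal.Quotient.eq_zero_iff_mem, map_sub, sub_eq_zero]
    have e1 := congrArg (fun M : Matrix n n (A ⧸ 𝔪 ^ (i + 1)) ↦ M j k) (ha i g)
    have e2 := congrArg (fun M : Matrix n n (A ⧸ 𝔪 ^ (i + 2)) ↦ M j k) (ha (i + 1) g)
    simp only [Matrix.map_apply] at e1 e2
    rw [e1, ← liftSeq_succ_apply hG θ₀ i g j k, ← hT, ← e2, Ideal.Quotient.factor_mk]
  have hcompat' : ∀ (g : G) (j k : n) {m l : ℕ}, m ≤ l →
      a m g j k ≡ a l g j k [SMOD (𝔪 ^ m • ⊤ : Submodule A A)] := by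
    intro g j k m l hml
    rw [SModEq.sub_mem, Ideal.smul_eq_mul, Ideal.mul_top]
    induction l, hml using Nat.le_induction with
    | base => simp
    | succ l hml ih =>
      have h2 : a l g j k - a (l + 1) g j k ∈ 𝔪 ^ m := by
        have := hcompat l g j k
        have h3 : 𝔪 ^ (l + 1) ≤ 𝔪 ^ m := Ideal.pow_le_pow_right (by omega)
        exact h3 (by rw [← neg_sub]; exact neg_mem_iff.mpr this)
      have := Ideal.add_mem _ ih h2
      rwa [sub_add_sub_cancel] at this
  -- the limits
  have hprec : ∀ (g : G) (j k : n), ∃ L : A, ∀ i : ℕ,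
      a i g j k ≡ L [SMOD (𝔪 ^ i • ⊤ : Submodule A A)] :=
    fun g j k ↦ IsPrecomplete.prec IsAdicComplete.toIsPrecomplete (hcompat' g j k)
  choose L hL using hprec
  set Θ : G → Matrix n n A := fun g ↦ Matrix.of (L g) with hΘ
  have hΘred : ∀ (i : ℕ) (g : G), (Θ g).map (Ideal.Quotient.mk (𝔪 ^ (i + 1))) =
      ((T i g : GL n _) : Matrix n n _) := by
    intro i g
    rw [← ha i g]
    ext j k
    simp only [Matrix.map_apply, hΘ, Matrix.of_apply]
    rw [Ideal.Quotient.mk_eq_mk_iff_sub_mem]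
    have h1 : a (i + 1) g j k - L g j k ∈ 𝔪 ^ (i + 1) := by
      have := hL g j k (i + 1)
      rwa [SModEq.sub_mem, Ideal.smul_eq_mul, Ideal.mul_top] at this
    have h2 := hcompat i g j k
    have := Ideal.sub_mem _ h1 h2
    rw [show a (i + 1) g j k - L g j k - (a (i + 1) g j k - a i g j k) = -(L g j k - a i g j k) by ring]
      at this
    exact (neg_mem_iff.mp this)
  -- `Θ` is multiplicative (Hausdorff)
  have hΘmul : ∀ g h, Θ (g * h) = Θ g * Θ h := by
    intro g h
    ext j k
    rw [← sub_eq_zero]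
    refine IsHausdorff.haus (IsAdicComplete.toIsHausdorff : IsHausdorff 𝔪 A) _ fun i ↦ ?_
    rw [SModEq.zero, Ideal.smul_eq_mul, Ideal.mul_top]
    rcases i with _ | i
    · simp
    rw [← Ideal.Quotient.eq_zero_iff_mem, map_sub, sub_eq_zero]
    have := congrArg (fun M : Matrix n n (A ⧸ 𝔪 ^ (i + 1)) ↦ M j k)
      (show (Θ (g * h)).map (Ideal.Quotient.mk (𝔪 ^ (i + 1))) =
        (Θ g).map (Ideal.Quotient.mk (𝔪 ^ (i + 1))) * (Θ h).map (Ideal.Quotient.mk (𝔪 ^ (i + 1)))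
        by rw [hΘred, hΘred, hΘred, map_mul, Units.val_mul])
    simpa [Matrix.map_apply, Matrix.mul_apply] using this
  -- reduction of `Θ` modulo `𝔪` is `σ`
  have hres : ∀ x, Ideal.Quotient.mk 𝔪 x = e₁ (Ideal.Quotient.mk (𝔪 ^ (0 + 1)) x) := fun x ↦ by
    rw [he₁, Ideal.quotEquivOfEq_mk]
  have hΘres : ∀ g, (Θ g).map (Ideal.Quotient.mk 𝔪) =
      ((σ' g : GL n (A ⧸ 𝔪)) : Matrix n n (A ⧸ 𝔪)) := by
    intro g
    have e2 : (Θ g).map (Ideal.Quotient.mk 𝔪) =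
        ((Θ g).map (Ideal.Quotient.mk (𝔪 ^ (0 + 1)))).map e₁ := by
      ext j k
      simp only [Matrix.map_apply, hres]
    rw [e2, hΘred 0 g, hT]
    change (((liftSeq hG θ₀ 0 g) : GL n (A ⧸ maximalIdeal A ^ (0 + 1))) :
      Matrix n n (A ⧸ maximalIdeal A ^ (0 + 1))).map e₁ = _
    rw [liftSeq, hθ₀]
    ext j k
    simp
  -- `Θ g` is invertible: it is invertible modulo `𝔪`
  have hΘunit : ∀ g, IsUnit (Θ g) := fun g ↦
    isUnit_of_isUnit_map_residue (Θ g) (by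
      change IsUnit ((Θ g).map (Ideal.Quotient.mk 𝔪))
      rw [hΘres]
      exact Units.isUnit (σ' g))
  set θ : G → GL n A := fun g ↦ (hΘunit g).unit with hθ
  have hθmul : ∀ g h, θ (g * h) = θ g * θ h := fun g h ↦ Units.ext (by
    simp only [hθ, IsUnit.unit_spec, Units.val_mul, hΘmul])
  refine ⟨MonoidHom.mk' θ hθmul, ?_⟩
  ext g : 1
  apply Units.ext
  change (((θ g : GL n A) : Matrix n n A)).map (Ideal.Quotient.mk 𝔪) =
    ((σ' g : GL n (A ⧸ 𝔪)) : Matrix n n (A ⧸ 𝔪))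
  simp only [hθ, IsUnit.unit_spec]
  exact hΘres g

/-- **Discharge of `SerreLRFG.prop43_lift`** (Serre §15.5 Prop. 43): for a complete discrete
valuation ring `A` of residue characteristic `p` and a finite group `G` of order prime to `p`,
every `σ : G → GL_n(k)` lifts to `GL_n(A)`. The order of `G` is a unit of `A` because it is
non-zero in the residue field (`SerreLRFG.natCard_ne_zero_iff`).
[cite: SerreLinearRepresentations1977, §15.5 Prop. 43] -/
theorem SerreLRFG.prop43_lift_holds : SerreLRFG.prop43_lift.{u, v} := by
  intro A _ _ _ _ _ p _ _ G _ _ hG n σ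
  classical
  letI := Fintype.ofFinite G
  have hcard : (Fintype.card G : ResidueField A) ≠ 0 := by
    rw [Fintype.card_eq_nat_card]
    exact (SerreLRFG.natCard_ne_zero_iff (A := A) p).mpr hG
  have hunit : IsUnit (Fintype.card G : A) := by
    rw [← IsLocalRing.notMem_maximalIdeal]
    intro hmem
    apply hcard
    rw [← map_natCast (IsLocalRing.residue A), IsLocalRing.residue_eq_zero_iff]
    exact hmem
  exact exists_lift_of_isAdicComplete hunit σ

end Main

end Literature.RepresentationTheory.FiniteGroups
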